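/-
Copyright (c) 2026 The decomp-a2c cell. All rights reserved.
Released under Apache 2.0 license as described in the file LICENSE.
-/
import Summits.AtomisticToContinuum.Crystallization.Theorems.ChartedZeroExcessLayeredLatticeLiouvilleWX

/-!
# ChartedZeroExcessLayeredLatticeLiouville — part WY «ProfileData»: the base comparison profile, its a-priori bounds, the carrier, the anchors
  (decomp-a2c-lens-2, g58; helper of stmt-AtomisticToContinuum-26636, leaf (PC) `ProfileComparisonAt`; memo NODE-g58d §3)

The non-arithmetic residue of (PC) after part WX:

* `base_profile`: for a field `φ` and a carrier `T` containing the flux box of `x₀.2`, VV `mode_extraction` with the slope `slopeAt φ x₀` and the flux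
  `colFlux T φ x₀.1 x₀.2` gives a profile `cf` with `columnFlux (slopeAt φ x₀) cf ≡ colFlux T φ x₀.1 x₀.2`, the comparison field
  `modeField (slopeAt φ x₀) cf` IS a `ϱ`-truncated mode (`IsTruncMode`, via VH `isTruncMode_of_profile` and the Lipschitz bound of a profile with
  bounded steps), and the CRUDE a-priori step bound `‖Δcf‖ ≤ modeConst·K·(392⌊ϱ/c⌋₊ + 1186)·√E` (`norm_colFlux_col_le`:
  `‖colFlux‖ ≤ K(392⌊ϱ/c⌋₊ + 304)√E` from WG `norm_fluxBlock_apply_le` / `norm_colPlanar_le` and single bonds `≤ √E`; `‖slopeAt‖ ≤ √E`) — it enters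
  only the thresholds of part WX;
* `colCarrier x₂ n = Icc (x₂ − (⌈n⌉₊ + 2)) (x₂ + ⌈n⌉₊ + 2)` with `|β − x₂| ≤ n + 2 ⇒ β ∈ colCarrier x₂ n` (the `hT₀` of WX
  `anchored_increment_le`);
* `exists_anchor`: for every integer offset `t` and `A ≤ 3L'` an anchor `s` with `|t − s| + A ≤ 3L'`, `|s| ≤ |t|`, `|t − s| ≤ |t|` and (`s = 0` or
  `|s| + (3L' − A) ≤ |t|`) — so the WX bound `(4M(driftConst+1)√864(|t − s| + A) + reanchorConst|s|)ε₁ ≤ (4M(driftConst+1)√864·A + reanchorConst)(|t| + 1)ε₁`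
  with a `ϱ`-FREE constant, and `|s| + 3⌊ϱ/c⌋₊ ≤ n/2` as soon as `3L' − A ≥ 3⌊ϱ/c⌋₊`;
* `anchorWidth c κ₀ ε` — an admissible `ϱ`-free `A` (`hA1`, `hA2` of WV/WX), and `sq_form_of_norm_le` — the conversion of a bound
  `‖v‖ ≤ C·t·√(E/(n²N))` into the (PC) currency `n²N‖v‖² ≤ C²t²E`.

What remains for `profileComparisonAt_holds` is real arithmetic only: `L' := ⌊(n/4 − 3⌊ϱ/c⌋₊)/6⌋₊`, `ε₁ := √(E/(n²N))` (or any positive majorant),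
`B₀ := √E + Bc + reanchorConst·(n/2)·ε₁`, and the verification of `hL1`, `hL2`, `A ≤ 3L' − 3⌊ϱ/c⌋₊` for `n ≥ n₁(ϱ)` (they compare
`n^{5/2}·poly(ϱ/c)` with `L'³`).
-/

namespace Summit.AtomisticToContinuum.Crystallization.Theorems.ChartedZeroExcessLayeredLatticeLiouville

open Summit.AtomisticToContinuum.Crystallization.Theorems.ChartedPlanarOrderRigidityDoor (E3)
open Finset
open scoped InnerProductSpace RealInnerProductSpace BigOperators

noncomputable section ProfileData

variable {c : ℝ} {a b : E3} {w : ℤ → E3}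

/-! ### WY.1  Profiles with bounded steps are Lipschitz; the extracted mode is a truncated mode -/

/-- band weights are at most one. [formal bookkeeping] -/
theorem bandWt_le_one (m k : ℤ) : bandWt m k ≤ 1 := by
  unfold bandWt
  have h0 : (0 : ℝ) ≤ ((((m - k).natAbs : ℕ)) : ℝ) := Nat.cast_nonneg _
  exact pow_le_one₀ (inv_nonneg.mpr (by linarith)) (inv_le_one_of_one_le₀ (by linarith))

/-- a profile with steps bounded by `δ` is `δ`-Lipschitz along the chain. [formal bookkeeping] -/
theorem norm_sub_le_of_steps_int (cf : ℤ → E3) {δ : ℝ} (h : ∀ k : ℤ, ‖cf (k + 1) - cf k‖ ≤ δ) (α β : ℤ) :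
    ‖cf β - cf α‖ ≤ δ * |((β - α : ℤ) : ℝ)| := by
  wlog hαβ : α ≤ β generalizing α β
  · have h' := this β α (le_of_not_ge hαβ)
    rw [norm_sub_rev] at h'
    have e : |((α - β : ℤ) : ℝ)| = |((β - α : ℤ) : ℝ)| := by
      push_cast
      exact abs_sub_comm _ _
    rwa [e] at h'
  obtain ⟨N, rfl⟩ : ∃ N : ℕ, β = α + N := ⟨(β - α).toNat, by omega⟩
  have hu : ∀ i < N, ‖(fun i : ℕ => cf (α + i)) (i + 1) - (fun i : ℕ => cf (α + i)) i‖ ≤ δ := fun i _ => by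
    have e : α + ((i + 1 : ℕ) : ℤ) = α + i + 1 := by push_cast; ring
    show ‖cf (α + ((i + 1 : ℕ) : ℤ)) - cf (α + i)‖ ≤ δ
    rw [e]
    exact h (α + i)
  have h3 : ‖cf (α + N) - cf (α + ((0 : ℕ) : ℤ))‖ ≤ |((N : ℕ) : ℝ) - ((0 : ℕ) : ℝ)| * δ :=
    norm_sub_le_of_steps (fun i : ℕ => cf (α + i)) hu le_rfl (Nat.zero_le N)
  rw [Nat.cast_zero, add_zero, Nat.cast_zero, sub_zero, Nat.abs_cast] at h3
  have e2 : |((α + (N : ℤ) - α : ℤ) : ℝ)| = (N : ℝ) := by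
    push_cast
    rw [add_sub_cancel_left, Nat.abs_cast]
  rw [e2, mul_comm]
  exact h3

/-- ★ a mode field with bounded profile steps that is truncated-harmonic everywhere IS a truncated mode (VH `isTruncMode_of_profile`). [this file, g58] -/
theorem isTruncMode_modeField_of_steps {ϱ : ℝ} (g : Fin 2 → E3) (cf : ℤ → E3) {δ : ℝ} (h : ∀ k : ℤ, ‖cf (k + 1) - cf k‖ ≤ δ)
    (hH : IsTruncHarmonicZ ϱ a b w (modeField g cf) Set.univ) : IsTruncMode ϱ a b w (modeField g cf) :=
  isTruncMode_of_profile g cf (m := δ) (fun α β => norm_sub_le_of_steps_int cf h α β) hH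

/-! ### WY.2  Crude a-priori bounds of the base data -/

/-- a unit bond of the ball, one step inside, is at most `√E`. [formal bookkeeping] -/
theorem norm_latDiff_le_sqrt_of_dist (φ : Cell 2 → ℤ → E3) (x₀ : Cell 2 × ℤ) {n : ℝ} (E : Cell 2 × ℤ) (hE : ∀ U : Cell 2 × ℤ, dist U (U + E) ≤ 1)
    {X : Cell 2 × ℤ} (hX : dist X x₀ + 1 ≤ n) : ‖latDiff E φ X.1 X.2‖ ≤ Real.sqrt (idxEnergy φ (idxBall x₀ n)) := by
  have hXn : dist X x₀ ≤ n := by linarith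
  have hXE : dist (X + E) x₀ ≤ n := by
    have h1 := hE X
    rw [dist_comm] at h1
    linarith [dist_triangle (X + E) X x₀]
  have h := norm_latDiff_sq_le_idxEnergy φ E hXn hXE (hE X)
  calc ‖latDiff E φ X.1 X.2‖ = Real.sqrt (‖latDiff E φ X.1 X.2‖ ^ 2) := (Real.sqrt_sq (norm_nonneg _)).symm
    _ ≤ Real.sqrt (idxEnergy φ (idxBall x₀ n)) := Real.sqrt_le_sqrt h

/-- the slope at the centre is at most `√E`. [formal bookkeeping] -/
theorem norm_slopeAt_le_sqrt (φ : Cell 2 → ℤ → E3) (x₀ : Cell 2 × ℤ) {n : ℝ} (hn : 1 ≤ n) (j : Fin 2) :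
    ‖slopeAt φ x₀ j‖ ≤ Real.sqrt (idxEnergy φ (idxBall x₀ n)) := by
  have h0 : dist x₀ x₀ + 1 ≤ n := by rw [dist_self]; linarith
  revert j
  rw [Fin.forall_fin_two]
  exact ⟨by rw [slopeAt_zero_eq]; exact norm_latDiff_le_sqrt_of_dist φ x₀ idxAxis₁ dist_add_idxAxis₁_le h0,
    by rw [slopeAt_one_eq]; exact norm_latDiff_le_sqrt_of_dist φ x₀ idxAxis₂ dist_add_idxAxis₂_le h0⟩

/-- the chain part of the crude column-flux bound: `‖chainFlux T (φ x₀.1) x₀.2‖ ≤ 196K(2⌊ϱ/c⌋₊ + 1)√E` (WG `norm_fluxBlock_apply_le`, band weights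
`≤ 1`, vertical bonds `≤ √E`). [formal bookkeeping] -/
theorem norm_chainFlux_col_le (hc : 0 < c) (hL : IsLayeredCrystal c a b w) {ϱ : ℝ} (φ : Cell 2 → ℤ → E3) (x₀ : Cell 2 × ℤ) {n : ℝ}
    (hn : 4 * (⌊ϱ / c⌋₊ : ℝ) + 2 ≤ n) {T : Finset ℤ} (hT : Icc (x₀.2 - ⌊ϱ / c⌋₊) (x₀.2 + 1 + ⌊ϱ / c⌋₊) ⊆ T) :
    ‖chainFlux ϱ a b w T (φ x₀.1) x₀.2‖ ≤ 196 * kernelConst c * ((2 * (⌊ϱ / c⌋₊ : ℝ) + 1) * Real.sqrt (idxEnergy φ (idxBall x₀ n))) := by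
  have hK0 := kernelConst_nonneg hc
  refine (norm_fluxBlock_apply_le hc hL (φ x₀.1) hT).trans (mul_le_mul_of_nonneg_left ?_ (by positivity))
  have hterm : ∀ k ∈ Icc (x₀.2 - ⌊ϱ / c⌋₊) (x₀.2 + ⌊ϱ / c⌋₊),
      bandWt x₀.2 k * ‖φ x₀.1 (k + 1) - φ x₀.1 k‖ ≤ Real.sqrt (idxEnergy φ (idxBall x₀ n)) := by
    intro k hk
    rw [mem_Icc] at hk
    have h1 : ((x₀.2 : ℤ) : ℝ) - (⌊ϱ / c⌋₊ : ℝ) ≤ (k : ℝ) := by exact_mod_cast hk.1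
    have h2 : ((k : ℤ) : ℝ) ≤ (x₀.2 : ℝ) + (⌊ϱ / c⌋₊ : ℝ) := by exact_mod_cast hk.2
    have hk' : |((k - x₀.2 : ℤ) : ℝ)| + 1 ≤ n := by
      have ha : |((k : ℤ) : ℝ) - (x₀.2 : ℝ)| ≤ (⌊ϱ / c⌋₊ : ℝ) := by
        rw [abs_le]
        constructor <;> linarith
      push_cast
      linarith
    have hD := norm_latDiff_axis₃_le_sqrt φ x₀ hk'
    rw [latDiff_axis₃_apply] at hD
    calc bandWt x₀.2 k * ‖φ x₀.1 (k + 1) - φ x₀.1 k‖ ≤ 1 * Real.sqrt (idxEnergy φ (idxBall x₀ n)) :=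
          mul_le_mul (bandWt_le_one _ _) hD (norm_nonneg _) zero_le_one
      _ = _ := one_mul _
  have hcard : (((Icc (x₀.2 - ⌊ϱ / c⌋₊) (x₀.2 + ⌊ϱ / c⌋₊)).card : ℕ) : ℝ) = 2 * (⌊ϱ / c⌋₊ : ℝ) + 1 := by
    rw [Int.card_Icc]
    have e : (x₀.2 + (⌊ϱ / c⌋₊ : ℤ) + 1 - (x₀.2 - (⌊ϱ / c⌋₊ : ℤ))).toNat = 2 * ⌊ϱ / c⌋₊ + 1 := by omega
    rw [e]
    push_cast
    ring
  calc ∑ k ∈ Icc (x₀.2 - ⌊ϱ / c⌋₊) (x₀.2 + ⌊ϱ / c⌋₊), bandWt x₀.2 k * ‖φ x₀.1 (k + 1) - φ x₀.1 k‖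
      ≤ ∑ k ∈ Icc (x₀.2 - ⌊ϱ / c⌋₊) (x₀.2 + ⌊ϱ / c⌋₊), Real.sqrt (idxEnergy φ (idxBall x₀ n)) := sum_le_sum hterm
    _ = (2 * (⌊ϱ / c⌋₊ : ℝ) + 1) * Real.sqrt (idxEnergy φ (idxBall x₀ n)) := by rw [sum_const, nsmul_eq_mul, hcard]

/-- the planar part of the crude column-flux bound: `‖colPlanar T φ x₀.1 x₀.2‖ ≤ 108K√E` (WG `norm_colPlanar_le`, in-plane bonds `≤ √E`).
[formal bookkeeping] -/
theorem norm_colPlanar_col_le (hc : 0 < c) (hL : IsLayeredCrystal c a b w) {ϱ : ℝ} (φ : Cell 2 → ℤ → E3) (x₀ : Cell 2 × ℤ) {n : ℝ}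
    (hn : 4 * (⌊ϱ / c⌋₊ : ℝ) + 2 ≤ n) (T : Finset ℤ) :
    ‖colPlanar ϱ a b w T φ x₀.1 x₀.2‖ ≤ 108 * kernelConst c * Real.sqrt (idxEnergy φ (idxBall x₀ n)) := by
  refine norm_colPlanar_le hc hL φ T x₀.1 x₀.2 (Real.sqrt_nonneg _) fun p β hp hβ1 hβ2 => ?_
  have hr0 : (0 : ℝ) ≤ (⌊ϱ / c⌋₊ : ℝ) := Nat.cast_nonneg _
  have hd : dist ((p, β) : Cell 2 × ℤ) x₀ + 1 ≤ n := by
    have h1 := dist_site_le x₀ β hp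
    have h2 : (0 : ℝ) ≤ ((β - x₀.2 : ℤ) : ℝ) := by exact_mod_cast (by omega : (0 : ℤ) ≤ β - x₀.2)
    have h3 : ((β - x₀.2 : ℤ) : ℝ) ≤ (⌊ϱ / c⌋₊ : ℝ) := by exact_mod_cast (by omega : β - x₀.2 ≤ (⌊ϱ / c⌋₊ : ℤ))
    rw [abs_of_nonneg h2] at h1
    linarith
  have hA := norm_latDiff_le_sqrt_of_dist φ x₀ idxAxis₁ dist_add_idxAxis₁_le hd
  have hB := norm_latDiff_le_sqrt_of_dist φ x₀ idxAxis₂ dist_add_idxAxis₂_le hd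
  exact ⟨hA, hB⟩

/-- ★ the CRUDE column-flux bound: `‖colFlux T φ x₀.1 x₀.2‖ ≤ K·(392⌊ϱ/c⌋₊ + 304)·√E`. [this file, g58] -/
theorem norm_colFlux_col_le (hc : 0 < c) (hL : IsLayeredCrystal c a b w) {ϱ : ℝ} (φ : Cell 2 → ℤ → E3) (x₀ : Cell 2 × ℤ) {n : ℝ}
    (hn : 4 * (⌊ϱ / c⌋₊ : ℝ) + 2 ≤ n) {T : Finset ℤ} (hT : Icc (x₀.2 - ⌊ϱ / c⌋₊) (x₀.2 + 1 + ⌊ϱ / c⌋₊) ⊆ T) :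
    ‖colFlux ϱ a b w T φ x₀.1 x₀.2‖ ≤ kernelConst c * (392 * (⌊ϱ / c⌋₊ : ℝ) + 304) * Real.sqrt (idxEnergy φ (idxBall x₀ n)) := by
  have hchain := norm_chainFlux_col_le hc hL φ x₀ hn hT
  have hplanar := norm_colPlanar_col_le hc hL φ x₀ hn T
  rw [colFlux_eq_chainFlux_add hc hL]
  refine (norm_add_le _ _).trans ?_
  calc ‖chainFlux ϱ a b w T (φ x₀.1) x₀.2‖ + ‖colPlanar ϱ a b w T φ x₀.1 x₀.2‖
      ≤ 196 * kernelConst c * ((2 * (⌊ϱ / c⌋₊ : ℝ) + 1) * Real.sqrt (idxEnergy φ (idxBall x₀ n))) +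
          108 * kernelConst c * Real.sqrt (idxEnergy φ (idxBall x₀ n)) := add_le_add hchain hplanar
    _ = _ := by ring

/-! ### WY.3  The base comparison profile -/

/-- ★★ THE BASE PROFILE: a `ϱ`-truncated MODE with slope `slopeAt φ x₀`, column flux `colFlux T φ x₀.1 x₀.2` and steps bounded a priori by
`modeConst·K·(392⌊ϱ/c⌋₊ + 1186)·√E` (VV `mode_extraction` + WY.1/WY.2). [this file, g58] -/
theorem base_profile (hc : 0 < c) (hL : IsLayeredCrystal c a b w) {κ₀ ε ϱ : ℝ} (hϱ : 0 ≤ ϱ) (hε : ε < 2 * κ₀)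
    (hK : CoerciveZ (layeredKernel a b w) κ₀)
    (hT : ∀ φ : Cell 2 → ℤ → E3, HasFiniteSupport φ → Summable (tailFam ϱ a b w φ) ∧ ∑' x, tailFam ϱ a b w φ x ≤ ε * nnFormZ φ)
    (φ : Cell 2 → ℤ → E3) (x₀ : Cell 2 × ℤ) {n : ℝ} (hn : 4 * (⌊ϱ / c⌋₊ : ℝ) + 2 ≤ n) {T : Finset ℤ}
    (hTx : Icc (x₀.2 - ⌊ϱ / c⌋₊) (x₀.2 + 1 + ⌊ϱ / c⌋₊) ⊆ T) :
    ∃ cf : ℤ → E3, IsTruncMode ϱ a b w (modeField (slopeAt φ x₀) cf) ∧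
      (∀ m : ℤ, columnFlux ϱ a b w ⌊ϱ / c⌋₊ (slopeAt φ x₀) cf m = colFlux ϱ a b w T φ x₀.1 x₀.2) ∧
      ∀ k : ℤ, ‖cf (k + 1) - cf k‖ ≤
        modeConst c (κ₀ - ε / 2) * kernelConst c * (392 * (⌊ϱ / c⌋₊ : ℝ) + 1186) * Real.sqrt (idxEnergy φ (idxBall x₀ n)) := by
  have hδ : 0 < κ₀ - ε / 2 := by linarith
  have hM0 := modeConst_nonneg c hδ
  have hK0 := kernelConst_nonneg hc
  have hr0 : (0 : ℝ) ≤ (⌊ϱ / c⌋₊ : ℝ) := Nat.cast_nonneg _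
  have hn1 : 1 ≤ n := by linarith
  obtain ⟨cf, hH, hF, hinc⟩ := mode_extraction hc hL hϱ hε hK hT (slopeAt φ x₀) (colFlux ϱ a b w T φ x₀.1 x₀.2)
  have hFn := norm_colFlux_col_le hc hL φ x₀ hn hTx
  have hg0 := norm_slopeAt_le_sqrt φ x₀ hn1 0
  have hg1 := norm_slopeAt_le_sqrt φ x₀ hn1 1
  have hstep : ∀ k : ℤ, ‖cf (k + 1) - cf k‖ ≤
      modeConst c (κ₀ - ε / 2) * kernelConst c * (392 * (⌊ϱ / c⌋₊ : ℝ) + 1186) * Real.sqrt (idxEnergy φ (idxBall x₀ n)) := by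
    intro k
    refine (hinc k).trans ?_
    calc modeConst c (κ₀ - ε / 2) * (‖colFlux ϱ a b w T φ x₀.1 x₀.2‖ + 441 * kernelConst c * (‖slopeAt φ x₀ 0‖ + ‖slopeAt φ x₀ 1‖))
        ≤ modeConst c (κ₀ - ε / 2) * (kernelConst c * (392 * (⌊ϱ / c⌋₊ : ℝ) + 304) * Real.sqrt (idxEnergy φ (idxBall x₀ n)) +
            441 * kernelConst c * (Real.sqrt (idxEnergy φ (idxBall x₀ n)) + Real.sqrt (idxEnergy φ (idxBall x₀ n)))) := by gcongr
      _ = _ := by ring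
  exact ⟨cf, isTruncMode_modeField_of_steps (slopeAt φ x₀) cf hstep hH, hF, hstep⟩

/-! ### WY.4  The carrier, the anchors, the width, the currency -/

/-- the column CARRIER of radius `⌈n⌉₊ + 2` about `x₂`: one carrier for all anchors. [this file, g58] -/
def colCarrier (x₂ : ℤ) (n : ℝ) : Finset ℤ :=
  Icc (x₂ - ((⌈n⌉₊ + 2 : ℕ) : ℤ)) (x₂ + ((⌈n⌉₊ + 2 : ℕ) : ℤ))

/-- every layer within `n + 2` of `x₂` lies in the carrier (the `hT₀` of WX `anchored_increment_le`). [formal bookkeeping] -/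
theorem mem_colCarrier {x₂ β : ℤ} {n : ℝ} (h : |((β - x₂ : ℤ) : ℝ)| ≤ n + 2) : β ∈ colCarrier x₂ n := by
  unfold colCarrier
  rw [mem_Icc]
  have hc : n ≤ (⌈n⌉₊ : ℝ) := Nat.le_ceil n
  have h2 : ((|β - x₂| : ℤ) : ℝ) ≤ (((⌈n⌉₊ + 2 : ℕ) : ℤ) : ℝ) := by
    rw [Int.cast_abs]
    push_cast at h ⊢
    linarith
  have hz : |β - x₂| ≤ ((⌈n⌉₊ + 2 : ℕ) : ℤ) := by exact_mod_cast h2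
  rw [abs_le] at hz
  constructor <;> linarith [hz.1, hz.2]

/-- the flux box of the centre lies in the carrier. [formal bookkeeping] -/
theorem box_subset_colCarrier (x₂ : ℤ) {n : ℝ} {r : ℕ} (hr : (r : ℝ) + 2 ≤ n + 2) : Icc (x₂ - r) (x₂ + 1 + r) ⊆ colCarrier x₂ n :=
  icc_subset_of_abs (fun _ h => mem_colCarrier h) (by rw [sub_self, Int.cast_zero, abs_zero]; linarith)

/-- ★ THE ANCHORS: every integer offset `t` has an anchor `s` with `|t − s| + A ≤ 3L'`, `|s| ≤ |t|`, `|t − s| ≤ |t|`, and either `s = 0` or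
`|s| + (3L' − A) ≤ |t|` (move from `t` towards `0` by `min(|t|, 3L' − A)`). [this file, g58] -/
theorem exists_anchor (t : ℤ) {A L' : ℕ} (hAL : A ≤ 3 * L') :
    ∃ s : ℤ, (t - s).natAbs + A ≤ 3 * L' ∧ s.natAbs ≤ t.natAbs ∧ (t - s).natAbs ≤ t.natAbs ∧ (s = 0 ∨ s.natAbs + (3 * L' - A) ≤ t.natAbs) := by
  by_cases h0 : t.natAbs + A ≤ 3 * L'
  · exact ⟨0, by omega, by omega, by omega, Or.inl rfl⟩
  by_cases ht : 0 ≤ t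
  · exact ⟨t - ((3 * L' - A : ℕ) : ℤ), by omega, by omega, by omega, Or.inr (by omega)⟩
  · exact ⟨t + ((3 * L' - A : ℕ) : ℤ), by omega, by omega, by omega, Or.inr (by omega)⟩

/-- an admissible `ϱ`-FREE bootstrap width `A` (thresholds `hA1`, `hA2` of parts WV/WX). [this file, g58] -/
def anchorWidth (c κ₀ ε : ℝ) : ℕ :=
  ⌈9408 * modeConst c (κ₀ - ε / 2) * kernelConst c⌉₊ + ⌈12 * modeConst c (κ₀ - ε / 2) * stabConst c (κ₀ - ε / 2)⌉₊ + 1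

/-- the width is at least one. [formal bookkeeping] -/
theorem one_le_anchorWidth (c κ₀ ε : ℝ) : 1 ≤ anchorWidth c κ₀ ε :=
  Nat.le_add_left 1 _

/-- the width satisfies `hA1`. [formal bookkeeping] -/
theorem anchorWidth_cube (c κ₀ ε : ℝ) : 9408 * modeConst c (κ₀ - ε / 2) * kernelConst c ≤ ((anchorWidth c κ₀ ε : ℕ) : ℝ) ^ 3 := by
  have h1 : 9408 * modeConst c (κ₀ - ε / 2) * kernelConst c ≤ ((anchorWidth c κ₀ ε : ℕ) : ℝ) := by
    unfold anchorWidth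
    push_cast
    linarith [Nat.le_ceil (9408 * modeConst c (κ₀ - ε / 2) * kernelConst c),
      Nat.cast_nonneg (α := ℝ) ⌈12 * modeConst c (κ₀ - ε / 2) * stabConst c (κ₀ - ε / 2)⌉₊]
  have h2 : (1 : ℝ) ≤ ((anchorWidth c κ₀ ε : ℕ) : ℝ) := by exact_mod_cast one_le_anchorWidth c κ₀ ε
  have h3 : ((anchorWidth c κ₀ ε : ℕ) : ℝ) ≤ ((anchorWidth c κ₀ ε : ℕ) : ℝ) ^ 3 := by
    nlinarith [mul_nonneg (sub_nonneg.mpr h2) (by positivity : (0 : ℝ) ≤ ((anchorWidth c κ₀ ε : ℕ) : ℝ) * (((anchorWidth c κ₀ ε : ℕ) : ℝ) + 1))]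
  exact h1.trans h3

/-- the width satisfies `hA2`. [formal bookkeeping] -/
theorem anchorWidth_sq (c κ₀ ε : ℝ) :
    12 * modeConst c (κ₀ - ε / 2) * stabConst c (κ₀ - ε / 2) ≤ (((anchorWidth c κ₀ ε : ℕ) : ℝ) + 2) ^ 2 := by
  have h1 : 12 * modeConst c (κ₀ - ε / 2) * stabConst c (κ₀ - ε / 2) ≤ ((anchorWidth c κ₀ ε : ℕ) : ℝ) := by
    unfold anchorWidth
    push_cast
    linarith [Nat.le_ceil (12 * modeConst c (κ₀ - ε / 2) * stabConst c (κ₀ - ε / 2)),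
      Nat.cast_nonneg (α := ℝ) ⌈9408 * modeConst c (κ₀ - ε / 2) * kernelConst c⌉₊]
  have h2 : (0 : ℝ) ≤ ((anchorWidth c κ₀ ε : ℕ) : ℝ) := Nat.cast_nonneg _
  nlinarith [mul_nonneg h2 h2]

/-- ★ THE (PC) CURRENCY: `‖v‖ ≤ C·t·√(E/(n²N))` gives `n²·N·‖v‖² ≤ C²·t²·E`. [formal bookkeeping] -/
theorem sq_form_of_norm_le {v : E3} {C t E n N : ℝ} (hn : 0 < n) (hN : 0 < N) (hE : 0 ≤ E)
    (h : ‖v‖ ≤ C * t * Real.sqrt (E / (n ^ 2 * N))) : n ^ 2 * N * ‖v‖ ^ 2 ≤ C ^ 2 * t ^ 2 * E := by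
  have h1 : ‖v‖ ^ 2 ≤ (C * t * Real.sqrt (E / (n ^ 2 * N))) ^ 2 := pow_le_pow_left₀ (norm_nonneg _) h 2
  rw [mul_pow, mul_pow, Real.sq_sqrt (by positivity)] at h1
  have hnN : n ^ 2 * N ≠ 0 := by positivity
  calc n ^ 2 * N * ‖v‖ ^ 2 ≤ n ^ 2 * N * (C ^ 2 * t ^ 2 * (E / (n ^ 2 * N))) := by gcongr
    _ = C ^ 2 * t ^ 2 * (E / (n ^ 2 * N) * (n ^ 2 * N)) := by ring
    _ = C ^ 2 * t ^ 2 * E := by rw [div_mul_cancel₀ E hnN]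

/-! ### WY.5  The closed statement of this part -/

/-- The content of part WY as one closed proposition: the base profile, the carrier, the anchors, the width and the currency. -/
def ProfileDataShape : Prop :=
  (∀ c : ℝ, ∀ hc : 0 < c, ∀ (a b : E3) (w : ℤ → E3), ∀ hL : IsLayeredCrystal c a b w, ∀ κ₀ ε ϱ : ℝ, 0 ≤ ϱ → ε < 2 * κ₀ →
    CoerciveZ (layeredKernel a b w) κ₀ →
    (∀ φ : Cell 2 → ℤ → E3, HasFiniteSupport φ → Summable (tailFam ϱ a b w φ) ∧ ∑' x, tailFam ϱ a b w φ x ≤ ε * nnFormZ φ) →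
    ∀ (φ : Cell 2 → ℤ → E3) (x₀ : Cell 2 × ℤ) (n : ℝ), 4 * (⌊ϱ / c⌋₊ : ℝ) + 2 ≤ n →
    ∀ T : Finset ℤ, Icc (x₀.2 - ⌊ϱ / c⌋₊) (x₀.2 + 1 + ⌊ϱ / c⌋₊) ⊆ T →
      ∃ cf : ℤ → E3, IsTruncMode ϱ a b w (modeField (slopeAt φ x₀) cf) ∧
        (∀ m : ℤ, columnFlux ϱ a b w ⌊ϱ / c⌋₊ (slopeAt φ x₀) cf m = colFlux ϱ a b w T φ x₀.1 x₀.2) ∧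
        ∀ k : ℤ, ‖cf (k + 1) - cf k‖ ≤
          modeConst c (κ₀ - ε / 2) * kernelConst c * (392 * (⌊ϱ / c⌋₊ : ℝ) + 1186) * Real.sqrt (idxEnergy φ (idxBall x₀ n))) ∧
  (∀ (x₂ β : ℤ) (n : ℝ), |((β - x₂ : ℤ) : ℝ)| ≤ n + 2 → β ∈ colCarrier x₂ n) ∧
  (∀ (x₂ : ℤ) (n : ℝ) (r : ℕ), (r : ℝ) + 2 ≤ n + 2 → Icc (x₂ - r) (x₂ + 1 + r) ⊆ colCarrier x₂ n) ∧
  (∀ (t : ℤ) (A L' : ℕ), A ≤ 3 * L' →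
    ∃ s : ℤ, (t - s).natAbs + A ≤ 3 * L' ∧ s.natAbs ≤ t.natAbs ∧ (t - s).natAbs ≤ t.natAbs ∧ (s = 0 ∨ s.natAbs + (3 * L' - A) ≤ t.natAbs)) ∧
  (∀ c κ₀ ε : ℝ, 1 ≤ anchorWidth c κ₀ ε ∧ 9408 * modeConst c (κ₀ - ε / 2) * kernelConst c ≤ ((anchorWidth c κ₀ ε : ℕ) : ℝ) ^ 3 ∧
    12 * modeConst c (κ₀ - ε / 2) * stabConst c (κ₀ - ε / 2) ≤ (((anchorWidth c κ₀ ε : ℕ) : ℝ) + 2) ^ 2) ∧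
  ∀ (v : E3) (C t E n N : ℝ), 0 < n → 0 < N → 0 ≤ E → ‖v‖ ≤ C * t * Real.sqrt (E / (n ^ 2 * N)) →
    n ^ 2 * N * ‖v‖ ^ 2 ≤ C ^ 2 * t ^ 2 * E

/-- WY holds. [this file, g58] -/
theorem profileDataShape_holds : ProfileDataShape :=
  ⟨fun _c hc _a _b _w hL _κ₀ _ε _ϱ hϱ hε hK hT φ x₀ _n hn _T hTx => base_profile hc hL hϱ hε hK hT φ x₀ hn hTx,
    fun _x₂ _β _n h => mem_colCarrier h,
    fun x₂ _n _r hr => box_subset_colCarrier x₂ hr,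
    fun t _A _L' hAL => exists_anchor t hAL,
    fun c κ₀ ε => ⟨one_le_anchorWidth c κ₀ ε, anchorWidth_cube c κ₀ ε, anchorWidth_sq c κ₀ ε⟩,
    fun _v _C _t _E _n _N hn hN hE h => sq_form_of_norm_le hn hN hE h⟩

end ProfileData

end Summit.AtomisticToContinuum.Crystallization.Theorems.ChartedZeroExcessLayeredLatticeLiouville
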